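import Summits.BirchSwinnertonDyer.BirchSwinnertonDyer.Theorems.PrintCf2RamifiedOffTYZMoverSquares
import Summits.BirchSwinnertonDyer.Rank1Residual.P2.PrintCf2GenusPeriodMoverRedeiTwo
import Literature.NumberTheory.EllipticCurves.Smith2016.CongruentNumberGenusDeterminantHolds
import Literature.NumberTheory.EllipticCurves.TianYuanZhang2017.CMPointClassFieldProofs
import HarnessLib

/-!
# Crux `PrintCf2.RamifiedOffTYZOfFacts` (stmt-BirchSwinnertonDyer-20509), line `offtyz-v7`, LEAD cycle 8 (cruxlead-20509 g7):
# GENUS-FIELD COORDINATES of an automorphism of `ℍ′_n` and their SURJECTIVITY on a block (Gauss's count through the ring class dictionary)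

THEOREMS ONLY (no `def`, no named fact, no `sorry`), `--supports stmt-BirchSwinnertonDyer-20509`.
For the genus-point data `D : GenusPointData n` and a block `d = q₁⋯q_m ∣ n` (`q` distinct odd primes) every automorphism `g` of `ℍ′_n` has
SIGN BITS `[g(i) = −i]`, `[g(√−q_j) = −√−q_j]`, `[g(i√−q_j) = −i√−q_j]` (`(i√−q_j)² = q_j`); this file proves their bookkeeping:
* §1 sign bits are additive in the element (products of `±`-eigenvectors) and in the automorphism;
* §2 on a block: `[g moves √−d] = [g moves i] + Σ_j [g moves i√−q_j]` (`∏_j i√−q_j = ±i√−d`); an automorphism fixing `√−d` and every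
  `i√−q_j` is trivial on `L_d(i)` (`trivialOnL_of_bits_eq_zero`), and conversely;
* §3 **surjectivity**: for a displayed block `d ≡ 5 (mod 8)` (`CMBlockSpec` + the ring class dictionary `RingClassTwoBlockSpec`), EVERY vector
  `v ∈ 𝔽₂^m` is the bit vector `([g moves i√−q_j])_j` of some `g ∈ Gal(ℍ′_n/K_d)` (`exists_mem_galK_bits_eq`): the bit map factors through
  `ρ_d : Gal(ℍ′_n/K_d) ↠ Pic(𝒪₂)` with kernel exactly the squares (RC3), and `#Pic(𝒪₂)/Pic(𝒪₂)² = #Pic(𝒪₂)[2] = #Cl(K_d)[2] = 2^m`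
  (ty2's `natCard_sq_eq_one_eq_of_ker_pair` + Gauss's count `natCard_sq_eq_one_eq`).
BSD is not proved by any of this; no class is closed by this file.

References: [cite: TianYuanZhang2017, §3.1 (p0011 L1–L13, L60–L64), proof of Lemma 3.21 (p0020 L55–L58)]; [cite: Cox2013, §3.B Prop. 3.11,
§7.D Thm. 7.24, §9.A]; crux note `Lines/offtyz_v7_QForm.md` §1–§2.
-/

noncomputable section

open scoped Classical NumberField

open WeierstrassCurve WeierstrassCurve.Affine Finset Literature.NumberTheory.EllipticCurves
  Literature.NumberTheory.EllipticCurves.TianYuanZhang2017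
  Literature.NumberTheory.EllipticCurves.TianYuanZhang2017.W2
  Literature.NumberTheory.EllipticCurves.Smith2016
  Literature.NumberTheory.QuadraticFields.RingClass
  Literature.NumberTheory.QuadraticFields
  Literature.NumberTheory.QuadraticFields.RedeiReichardt
  Summit.BirchSwinnertonDyer.Rank1Residual.P2.GenusPeriodTransferLayer

set_option autoImplicit false

namespace Summit.BirchSwinnertonDyer.PrintCf2.MoverAssembly

/-! ## §1 Sign bits -/

section SignBits

variable {F : Type*} [Field F] [CharZero F]

/-- In characteristic zero, `a = −a` forces `a = 0`. [folklore] -/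
theorem eq_zero_of_eq_neg' {a : F} (h : a = -a) : a = 0 := by
  have : (2 : F) * a = 0 := by linear_combination h
  simpa using this

/-- **Sign bits are additive in the element**: if `g a = ±a`, `g b = ±b` with `a, b ≠ 0`, then
`[g(ab) = −ab]`-bit `= [g a = −a] + [g b = −b]` in `𝔽₂`, where the bit of `x` is `if g x = x then 0 else 1`. [folklore] -/
theorem bit_mul (g : F →+* F) {a b : F} (ha : g a = a ∨ g a = -a) (hb : g b = b ∨ g b = -b) (ha0 : a ≠ 0) (hb0 : b ≠ 0) :
    (if g (a * b) = a * b then (0 : ZMod 2) else 1) =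
      (if g a = a then (0 : ZMod 2) else 1) + (if g b = b then (0 : ZMod 2) else 1) := by
  have hab0 : a * b ≠ 0 := mul_ne_zero ha0 hb0
  have hna : ¬ (-a = a) := fun h => ha0 (eq_zero_of_eq_neg' h.symm)
  have hnb : ¬ (-b = b) := fun h => hb0 (eq_zero_of_eq_neg' h.symm)
  have hnab : ¬ (-(a * b) = a * b) := fun h => hab0 (eq_zero_of_eq_neg' h.symm)
  rw [map_mul]
  rcases ha with ha | ha <;> rcases hb with hb | hb <;> rw [ha, hb]
  · simp
  · rw [if_pos rfl, if_neg hnb, mul_neg, if_neg hnab]; decide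
  · rw [if_neg hna, if_pos rfl, neg_mul, if_neg hnab]; decide
  · rw [if_neg hna, if_neg hnb, neg_mul_neg, if_pos rfl]; decide

omit [CharZero F] in
/-- An element moved to `±` itself has its products moved to `±` themselves. [folklore] -/
theorem apply_mul_eq_or (g : F →+* F) {a b : F} (ha : g a = a ∨ g a = -a) (hb : g b = b ∨ g b = -b) :
    g (a * b) = a * b ∨ g (a * b) = -(a * b) := by
  rw [map_mul]
  rcases ha with ha | ha <;> rcases hb with hb | hb <;> rw [ha, hb]
  · left; rfl
  · right; ring
  · right; ring
  · left; ring

/-- **Sign bits are additive over products**: for a finite family of non-zero `±`-eigenvectors of `g`. [folklore] -/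
theorem bit_prod (g : F →+* F) {ι : Type*} (s : Finset ι) (a : ι → F)
    (ha : ∀ i ∈ s, g (a i) = a i ∨ g (a i) = -(a i)) (ha0 : ∀ i ∈ s, a i ≠ 0) :
    (g (∏ i ∈ s, a i) = ∏ i ∈ s, a i ∨ g (∏ i ∈ s, a i) = -∏ i ∈ s, a i) ∧
      (if g (∏ i ∈ s, a i) = ∏ i ∈ s, a i then (0 : ZMod 2) else 1) =
        ∑ i ∈ s, (if g (a i) = a i then (0 : ZMod 2) else 1) := by
  induction s using Finset.induction_on with
  | empty => simp
  | insert j s hj ih =>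
    obtain ⟨ihor, ihbit⟩ := ih (fun i hi => ha i (mem_insert_of_mem hi)) (fun i hi => ha0 i (mem_insert_of_mem hi))
    have haj := ha j (mem_insert_self j s)
    have haj0 := ha0 j (mem_insert_self j s)
    have hprod0 : ∏ i ∈ s, a i ≠ 0 := Finset.prod_ne_zero_iff.mpr fun i hi => ha0 i (mem_insert_of_mem hi)
    rw [Finset.prod_insert hj, Finset.sum_insert hj]
    exact ⟨apply_mul_eq_or g haj ihor, by rw [bit_mul g haj ihor haj0 hprod0, ihbit]⟩

omit [CharZero F] in
/-- A unit multiple `b = u·a` with `g u = u`, `u ≠ 0` has the same sign bit as `a`. [folklore] -/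
theorem bit_eq_of_eq_mul (g : F →+* F) {a b u : F} (hu : g u = u) (hu0 : u ≠ 0) (hb : b = u * a) :
    (if g b = b then (0 : ZMod 2) else 1) = (if g a = a then (0 : ZMod 2) else 1) := by
  subst hb
  rw [map_mul, hu]
  by_cases h : g a = a
  · rw [h, if_pos rfl, if_pos rfl]
  · rw [if_neg h, if_neg (fun h' => h (mul_left_cancel₀ hu0 h'))]

/-- **Sign bits are additive in the automorphism**: `[gh·a = −a] = [g a = −a] + [h a = −a]` for a non-zero `±`-eigenvector `a` of both.
[folklore] -/
theorem bit_comp (g h : F →+* F) {a : F} (ha : g a = a ∨ g a = -a) (hb : h a = a ∨ h a = -a) (ha0 : a ≠ 0) :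
    (if g (h a) = a then (0 : ZMod 2) else 1) =
      (if g a = a then (0 : ZMod 2) else 1) + (if h a = a then (0 : ZMod 2) else 1) := by
  have hna : ¬ (-a = a) := fun h => ha0 (eq_zero_of_eq_neg' h.symm)
  rcases ha with ha | ha <;> rcases hb with hb | hb
  · simp [hb, ha]
  · simp [hb, ha, hna]
  · simp [hb, ha, hna]
  · simp [hb, ha, hna]; decide

omit [CharZero F] in
/-- A square root of a `g`-fixed non-zero square is a `±`-eigenvector: `a² = c`, `g c = c` ⟹ `g a = ±a`. [folklore] -/
theorem apply_eq_or_of_sq_eq (g : F →+* F) {a c : F} (hac : a ^ 2 = c) (hc : g c = c) : g a = a ∨ g a = -a := by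
  apply eq_or_eq_neg_of_sq_eq_sq'
  rw [← map_pow, hac, hc]

end SignBits

/-! ## §2 The coordinates on a block -/

variable {n : ℕ} (D : GenusPointData n)

/-- `(i·√−q)² = q` for `q ∣ n`. [cite: TianYuanZhang2017, proof of Lemma 3.21 (p0020 L55–L58: L_n(i) = ℚ(i, √d : d ∣ n))] -/
theorem im_mul_sqrtNeg_sq {q : ℕ} (hq : q ∈ n.divisors) : (D.im * D.sqrtNeg q) ^ 2 = (q : D.H) := by
  rw [mul_pow, D.im_sq, D.sqrtNeg_sq q hq]; ring

/-- Every automorphism of `ℍ′_n` maps `i·√−q` (`q ∣ n`) to `±` itself. [cite: TianYuanZhang2017, §3.1 (p0011 L60–L64)] -/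
theorem apply_im_mul_sqrtNeg_eq_or (g : D.H ≃ₐ[ℚ] D.H) {q : ℕ} (hq : q ∈ n.divisors) :
    g (D.im * D.sqrtNeg q) = D.im * D.sqrtNeg q ∨ g (D.im * D.sqrtNeg q) = -(D.im * D.sqrtNeg q) :=
  apply_eq_or_of_sq_eq (g : D.H →+* D.H) (im_mul_sqrtNeg_sq D hq) (map_natCast _ q)

/-- `i·√−q ≠ 0`. [cite: TianYuanZhang2017, §3.1 (p0011 L60–L64)] -/
theorem im_mul_sqrtNeg_ne_zero {q : ℕ} (hq : q ∈ n.divisors) : D.im * D.sqrtNeg q ≠ 0 :=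
  mul_ne_zero (D.im_ne_zero) (D.sqrtNeg_ne_zero hq)

variable {m : ℕ} (q : Fin m → ℕ) (hq : ∀ j, (q j).Prime) (hqodd : ∀ j, Odd (q j)) (hqinj : Function.Injective q)

/-- The block divisors: `q_j ∣ d = ∏ q`, so `q_j ∈ n.divisors` when `d ∈ n.divisors`. [cite: TianYuanZhang2017, §3.1 (p0011 L60–L64)] -/
theorem mem_divisors_of_block {d : ℕ} (hd : d ∈ n.divisors) (hprod : ∏ j, q j = d) (j : Fin m) : q j ∈ n.divisors :=
  Nat.divisors_subset_of_dvd (Nat.mem_divisors.mp hd).2 (Nat.dvd_of_mem_divisors hd)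
    (Nat.mem_divisors.mpr ⟨hprod ▸ Finset.dvd_prod_of_mem q (mem_univ j), by
      rintro rfl; simp at hd⟩)

/-- **`∏_j (i·√−q_j) = ± i·√−d`** on a block `d = ∏ q_j ∣ n` (both square to `d`). [cite: TianYuanZhang2017, §2.1 (J725 L11–L16) and §3.1 (p0011 L60–L64)] -/
theorem prod_im_mul_sqrtNeg_eq_or {d : ℕ} (hd : d ∈ n.divisors) (hprod : ∏ j, q j = d) :
    (∏ j, D.im * D.sqrtNeg (q j)) = D.im * D.sqrtNeg d ∨ (∏ j, D.im * D.sqrtNeg (q j)) = -(D.im * D.sqrtNeg d) := by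
  apply eq_or_eq_neg_of_sq_eq_sq'
  rw [← Finset.prod_pow, Finset.prod_congr rfl fun j _ => im_mul_sqrtNeg_sq D (mem_divisors_of_block q hd hprod j),
    ← Nat.cast_prod, hprod, mul_pow, D.im_sq, D.sqrtNeg_sq d hd]
  ring

/-- **The block relation of the coordinates**: `[g moves √−d] = [g moves i] + Σ_j [g moves i·√−q_j]` for every automorphism `g` of `ℍ′_n`
(`d = ∏ q_j ∣ n`). [cite: TianYuanZhang2017, §3.1 (p0011 L60–L64) and proof of Lemma 3.21 (p0020 L55–L58)] -/
theorem bit_sqrtNeg_eq_bit_im_add_sum {d : ℕ} (hd : d ∈ n.divisors) (hprod : ∏ j, q j = d) (g : D.H ≃ₐ[ℚ] D.H) :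
    (if g (D.sqrtNeg d) = D.sqrtNeg d then (0 : ZMod 2) else 1) =
      (if g D.im = D.im then (0 : ZMod 2) else 1) + ∑ j, (if g (D.im * D.sqrtNeg (q j)) = D.im * D.sqrtNeg (q j) then (0 : ZMod 2) else 1) := by
  have hbits := (bit_prod (g : D.H →+* D.H) univ (fun j => D.im * D.sqrtNeg (q j))
    (fun j _ => apply_im_mul_sqrtNeg_eq_or D g (mem_divisors_of_block q hd hprod j))
    (fun j _ => im_mul_sqrtNeg_ne_zero D (mem_divisors_of_block q hd hprod j))).2
  have hprodbit : (if g (∏ j, D.im * D.sqrtNeg (q j)) = ∏ j, D.im * D.sqrtNeg (q j) then (0 : ZMod 2) else 1) =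
      (if g (D.im * D.sqrtNeg d) = D.im * D.sqrtNeg d then (0 : ZMod 2) else 1) := by
    rcases prod_im_mul_sqrtNeg_eq_or D q hd hprod with h | h
    · rw [h]
    · exact bit_eq_of_eq_mul (g : D.H →+* D.H) (u := -1) (by simp) (by norm_num) (by rw [h]; ring)
  have himd : (if g (D.im * D.sqrtNeg d) = D.im * D.sqrtNeg d then (0 : ZMod 2) else 1) =
      (if g D.im = D.im then (0 : ZMod 2) else 1) + (if g (D.sqrtNeg d) = D.sqrtNeg d then (0 : ZMod 2) else 1) :=
    bit_mul (g : D.H →+* D.H) (apply_im_eq_or D g) (apply_sqrtNeg_eq_or D g hd) D.im_ne_zero (D.sqrtNeg_ne_zero hd)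
  -- solve for the `√−d` bit
  have e : ∀ x y z : ZMod 2, z = x + y → z = (∑ j, (if g (D.im * D.sqrtNeg (q j)) = D.im * D.sqrtNeg (q j) then (0 : ZMod 2) else 1)) →
      y = x + ∑ j, (if g (D.im * D.sqrtNeg (q j)) = D.im * D.sqrtNeg (q j) then (0 : ZMod 2) else 1) := by
    intro x y z h1 h2
    have hxx : x + x = 0 := CharTwo.add_self_eq_zero x
    calc y = x + x + y := by rw [hxx, zero_add]
      _ = x + z := by rw [h1, add_assoc]
      _ = _ := by rw [h2]
  exact e _ _ _ himd (hprodbit.symm.trans hbits)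

include hq hqinj in
/-- **An automorphism fixing `√−d`, `i` and every `√−q_j` is trivial on `L_d(i)`** (`d = ∏ q_j ∣ n`, `n` square-free): every `√−d′`,
`d′ ∣ d`, is `±i^a ∏_{q_j ∣ d′} √−q_j`. [cite: TianYuanZhang2017, proof of Lemma 3.21 (p0020 L55–L58: L_n(i) = ℚ(i, √d : d ∣ n))] -/
theorem trivialOnL_of_fix (hn : Squarefree n) {d : ℕ} (hd : d ∈ n.divisors) (hprod : ∏ j, q j = d) {g : D.H ≃ₐ[ℚ] D.H}
    (hgi : g D.im = D.im) (hgq : ∀ j, g (D.sqrtNeg (q j)) = D.sqrtNeg (q j)) : D.TrivialOnL d g := by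
  refine ⟨hgi, fun d' hd' _ => ?_⟩
  have hd'n : d' ∈ n.divisors := Nat.divisors_subset_of_dvd hn.ne_zero (Nat.dvd_of_mem_divisors hd) hd'
  -- `d' = ∏_{j ∈ T} q_j`
  have hd'dvd : d' ∣ ∏ j ∈ (univ : Finset (Fin m)), q j := by rw [hprod]; exact Nat.dvd_of_mem_divisors hd'
  set T := (univ : Finset (Fin m)).filter (fun j => q j ∣ d') with hT
  have hd'T : d' = ∏ j ∈ T, q j := eq_blockProd_filter_of_dvd q hq hqinj univ hd'dvd
  -- `(∏_T √−q_j)² = (−1)^|T| d'`, `(√−d')² = −d'`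
  have hsq : (D.sqrtNeg d') ^ 2 = (D.im ^ (T.card + 1) * ∏ j ∈ T, D.sqrtNeg (q j)) ^ 2 := by
    have hi : (D.im ^ (T.card + 1)) ^ 2 = (-1) ^ (T.card + 1) := by
      rw [← pow_mul, pow_mul', D.im_sq]
    have h1 : ((-1 : D.H) ^ (T.card + 1)) * (-1) ^ T.card = -1 := by
      rw [← pow_add, show T.card + 1 + T.card = 2 * T.card + 1 by ring, pow_succ, pow_mul, neg_one_sq, one_pow, one_mul]
    rw [D.sqrtNeg_sq d' hd'n, mul_pow, hi, ← Finset.prod_pow,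
      Finset.prod_congr rfl fun j _ => D.sqrtNeg_sq (q j) (mem_divisors_of_block q hd hprod j),
      Finset.prod_neg, ← Nat.cast_prod, ← hd'T]
    linear_combination (-(d' : D.H)) * h1
  have hfixprod : g (D.im ^ (T.card + 1) * ∏ j ∈ T, D.sqrtNeg (q j)) = D.im ^ (T.card + 1) * ∏ j ∈ T, D.sqrtNeg (q j) := by
    rw [map_mul, map_pow, hgi, map_prod]
    exact congrArg _ (Finset.prod_congr rfl fun j _ => hgq j)
  rcases eq_or_eq_neg_of_sq_eq_sq' hsq with h | h
  · rw [h, hfixprod]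
  · rw [h, map_neg, hfixprod]

include hq hqinj in
/-- **An automorphism of `Gal(ℍ′_n/K_d)` with all bits `[g moves i·√−q_j] = 0` is trivial on `L_d(i)`** (it then fixes `i` by the block
relation, hence every `√−q_j`). [cite: TianYuanZhang2017, proof of Lemma 3.21 (p0020 L55–L58)] -/
theorem trivialOnL_of_bits_eq_zero (hn : Squarefree n) {d : ℕ} (hd : d ∈ n.divisors) (hprod : ∏ j, q j = d)
    {g : D.H ≃ₐ[ℚ] D.H} (hgd : g (D.sqrtNeg d) = D.sqrtNeg d) (hbits : ∀ j, g (D.im * D.sqrtNeg (q j)) = D.im * D.sqrtNeg (q j)) :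
    D.TrivialOnL d g := by
  have hrel := bit_sqrtNeg_eq_bit_im_add_sum D q hd hprod g
  rw [if_pos hgd, Finset.sum_eq_zero (fun j _ => if_pos (hbits j)), add_zero] at hrel
  have hgi : g D.im = D.im := by
    by_contra h; rw [if_neg h] at hrel; exact zero_ne_one hrel
  refine trivialOnL_of_fix D q hq hqinj hn hd hprod hgi fun j => ?_
  have h := hbits j
  rw [map_mul, hgi] at h
  exact mul_left_cancel₀ D.im_ne_zero h

/-- Conversely, an automorphism trivial on `L_d(i)` has all bits `[g moves i·√−q_j] = 0` (`q_j ∣ d` prime).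
[cite: TianYuanZhang2017, proof of Lemma 3.21 (p0020 L55–L58)] -/
theorem bits_eq_zero_of_trivialOnL {d : ℕ} (hprod : ∏ j, q j = d) (hq1 : ∀ j, 1 < q j) {g : D.H ≃ₐ[ℚ] D.H}
    (hg : D.TrivialOnL d g) (j : Fin m) : g (D.im * D.sqrtNeg (q j)) = D.im * D.sqrtNeg (q j) := by
  have hd0 : d ≠ 0 := by
    rw [← hprod]; exact Finset.prod_ne_zero_iff.mpr fun j _ => by have := hq1 j; omega
  rw [map_mul, hg.1, hg.2 (q j) (Nat.mem_divisors.mpr ⟨hprod ▸ Finset.dvd_prod_of_mem q (mem_univ j), hd0⟩) (hq1 j)]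

/-! ## §3 Surjectivity of the bit vector on a displayed block (Gauss's count through the ring class dictionary) -/

/-- `#A = #A² · #A[2]` for a finite abelian group (first isomorphism theorem for squaring). [cite: Rotman1995, Thm. 2.24 (PDF p. 43)] -/
private theorem natCard_eq_natCard_isSquare_mul' (A : Type*) [CommGroup A] [Finite A] :
    Nat.card A = Nat.card {a : A // IsSquare a} * Nat.card {a : A // a ^ 2 = 1} := by
  let f : A →* A := powMonoidHom 2
  have h1 : Nat.card A = Nat.card (A ⧸ f.ker) * Nat.card f.ker :=
    Subgroup.card_eq_card_quotient_mul_card_subgroup f.ker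
  have h2 : Nat.card (A ⧸ f.ker) = Nat.card f.range :=
    Nat.card_congr (QuotientGroup.quotientKerEquivRange f).toEquiv
  have h3 : Nat.card f.range = Nat.card {a : A // IsSquare a} := by
    refine Nat.card_congr (Equiv.subtypeEquivRight fun a => ?_)
    rw [MonoidHom.mem_range]
    constructor
    · rintro ⟨y, hy⟩
      exact ⟨y, by rw [← hy, powMonoidHom_apply, sq]⟩
    · rintro ⟨r, hr⟩
      exact ⟨r, by rw [powMonoidHom_apply, sq, hr]⟩
  have h4 : Nat.card f.ker = Nat.card {a : A // a ^ 2 = 1} :=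
    Nat.card_congr (Equiv.subtypeEquivRight fun c => by rw [MonoidHom.mem_ker, powMonoidHom_apply])
  rw [h1, h2, h3, h4]

include hq hqodd hqinj in
/-- **`#Pic(𝒪₂)(K_d) = 2^m · #Pic(𝒪₂)²`** for a displayed block `d = ∏ q_j ≡ 5 (mod 8)` of a square-free `n` (`m` odd primes):
`#G = #G²·#G[2]`, `#G[2] = #Cl(K_d)[2]` (ty2, kernel pair `{1, κ}`, `κ = ρ_d(σ)`), `#Cl(K_d)[2] = 2^{(m+1)−1}` (Gauss, prime tuple `(2; q)` of
`d_K = −4d`). [cite: Cox2013, §3.B Prop. 3.11 and §7.D Thm. 7.24] [cite: TianYuanZhang2017, Prop. 3.2 (1)] -/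
theorem natCard_ringClassGroup_two_eq (hn : Squarefree n) {d : ℕ} (hd : d ∈ n.divisors) (hd8 : d % 8 = 5) (hprod : ∏ j, q j = d)
    {z : APoint D.H} {Φ : Finset (D.H ≃ₐ[ℚ] D.H)} {ΓH ΓH' : Subgroup (D.H ≃ₐ[ℚ] D.H)} {σ c : D.H ≃ₐ[ℚ] D.H}
    (h : D.CMBlockSpec d z Φ ΓH ΓH' σ c) {ρ : D.galK d →* RingClassGroup (GenusField d) 2}
    (hρ : D.RingClassTwoBlockSpec d ΓH ΓH' ρ) :
    Nat.card (RingClassGroup (GenusField d) 2) = Nat.card {y : RingClassGroup (GenusField d) 2 // IsSquare y} * 2 ^ m := by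
  have hd1 : 1 ≤ d := by omega
  haveI : Finite (RingClassGroup (GenusField d) 2) := finite_ringClassGroup (K := GenusField d) (finrank_genusField d) two_ne_zero
  obtain ⟨hκ1, hκcl, -⟩ := kappa_spec_of_ringClass D hd hd8 h hρ
  have hκsq : IsSquare (ρ ⟨σ, D.sigma_mem_galK_of_cmBlockSpec h⟩) :=
    (hρ.2.2.2 _).mp (sigma_trivialOnL_and_not_mem_of_cmBlockSpec D hd hd8 h).1
  have hdsq : Squarefree d := hn.squarefree_of_dvd (Nat.dvd_of_mem_divisors hd)
  obtain ⟨hneg, heven, hne⟩ := discr_genusField_neg_even_ne hdsq (by omega) (by omega)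
  have hπ := FourRankOne.toClassGroup_surjective_of_discr_neg (K := GenusField d) (finrank_genusField d) hneg two_ne_zero
  have hker := FourRankOne.toClassGroup_two_eq_one_iff (K := GenusField d) (finrank_genusField d) hneg heven hne hκcl hκ1
  rw [natCard_eq_natCard_isSquare_mul' (RingClassGroup (GenusField d) 2),
    natCard_sq_eq_one_eq_of_ker_pair (toClassGroup (GenusField d) 2) hπ hker hκ1 hκsq]
  congr 1
  -- Gauss: `#Cl(K_d)[2] = 2^{t-1}` with `t = m + 1`
  obtain ⟨x, -, hx⟩ := exists_ringOfIntegers_sq_eq_neg (K := GenusField d) (x := AdjoinRoot.root (genusFieldPoly d)) (n := d)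
    (by exact_mod_cast root_genusField_sq hd1)
  have h4 : (∏ j, q j) % 4 = 1 := by rw [hprod]; omega
  have h := natCard_sq_eq_one_eq (finrank_genusField d) hx (prime_cons_two q hq) (injective_cons_two q hqodd hqinj)
    (by rw [prod_cons_two q h4, hprod])
  rw [h]
  simp

include hq hqodd hqinj in
/-- **SURJECTIVITY OF THE BIT VECTOR on a displayed block `d ≡ 5 (mod 8)`**: for every `v ∈ 𝔽₂^m` there is `g ∈ Gal(ℍ′_n/K_d)` with
`[g moves i·√−q_j] = v_j` for all `j`.  The bit map is a homomorphism `Gal(ℍ′_n/K_d) → 𝔽₂^m` killing `ker ρ_d = Gal(ℍ′_n/H′_d)`; it descends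
to `Pic(𝒪₂)` with kernel EXACTLY the squares (RC3: trivial on `L_d(i)` ⟺ square), so its image has `#Pic(𝒪₂)/#Pic(𝒪₂)² = 2^m` elements.
[cite: TianYuanZhang2017, §3.1 (p0011 L1–L13), proof of Lemma 3.21 (p0020 L55–L58)] [cite: Cox2013, §3.B Prop. 3.11, §9.A] -/
theorem exists_mem_galK_bits_eq (hn : Squarefree n) {d : ℕ} (hd : d ∈ n.divisors) (hd8 : d % 8 = 5) (hprod : ∏ j, q j = d)
    {z : APoint D.H} {Φ : Finset (D.H ≃ₐ[ℚ] D.H)} {ΓH ΓH' : Subgroup (D.H ≃ₐ[ℚ] D.H)} {σ c : D.H ≃ₐ[ℚ] D.H}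
    (h : D.CMBlockSpec d z Φ ΓH ΓH' σ c) {ρ : D.galK d →* RingClassGroup (GenusField d) 2}
    (hρ : D.RingClassTwoBlockSpec d ΓH ΓH' ρ) (v : Fin m → ZMod 2) :
    ∃ g : D.H ≃ₐ[ℚ] D.H, g (D.sqrtNeg d) = D.sqrtNeg d ∧
      ∀ j, (if g (D.im * D.sqrtNeg (q j)) = D.im * D.sqrtNeg (q j) then (0 : ZMod 2) else 1) = v j := by
  have hd1 : 1 < d := by omega
  have hd4 : d % 4 = 1 := by omega
  haveI : Finite (RingClassGroup (GenusField d) 2) := finite_ringClassGroup (K := GenusField d) (finrank_genusField d) two_ne_zero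
  have hqn : ∀ j, q j ∈ n.divisors := mem_divisors_of_block q hd hprod
  have hq1 : ∀ j, 1 < q j := fun j => (hq j).one_lt
  have hsurj := hρ.1
  have hkerρ := hρ.2.1
  have hsq := hρ.2.2.2
  -- the bit homomorphism on `Gal(ℍ′_n/K_d)`
  let bits : D.galK d → Multiplicative (Fin m → ZMod 2) := fun g =>
    Multiplicative.ofAdd fun j => if (g : D.H ≃ₐ[ℚ] D.H) (D.im * D.sqrtNeg (q j)) = D.im * D.sqrtNeg (q j) then (0 : ZMod 2) else 1
  have hbits_mul : ∀ a b : D.galK d, bits (a * b) = bits a * bits b := by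
    intro a b
    change Multiplicative.ofAdd _ = Multiplicative.ofAdd _ * Multiplicative.ofAdd _
    rw [← ofAdd_add]
    congr 1
    funext j
    rw [Pi.add_apply]
    exact bit_comp ((a : D.H ≃ₐ[ℚ] D.H) : D.H →+* D.H) ((b : D.H ≃ₐ[ℚ] D.H) : D.H →+* D.H)
      (apply_im_mul_sqrtNeg_eq_or D _ (hqn j)) (apply_im_mul_sqrtNeg_eq_or D _ (hqn j)) (im_mul_sqrtNeg_ne_zero D (hqn j))
  have hbits_one : bits 1 = 1 := by
    change Multiplicative.ofAdd _ = Multiplicative.ofAdd 0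
    congr 1
    funext j
    rw [Pi.zero_apply]
    exact if_pos rfl
  let f : D.galK d →* Multiplicative (Fin m → ZMod 2) := { toFun := bits, map_one' := hbits_one, map_mul' := hbits_mul }
  have hf : ∀ g : D.galK d, f g = bits g := fun _ => rfl
  -- `ker ρ ≤ ker f`
  have hker : ρ.ker ≤ f.ker := by
    intro g hg
    rw [MonoidHom.mem_ker] at hg ⊢
    have hΓ' : (g : D.H ≃ₐ[ℚ] D.H) ∈ ΓH' := (hkerρ g).mp hg
    have hL : D.TrivialOnL d g :=
      trivialOnL_of_fixesGenusField D hd hd4 hd1 (h.2.2.2.1.2 _ (h.2.2.2.1.1 _ hΓ'))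
    rw [hf]
    change Multiplicative.ofAdd _ = Multiplicative.ofAdd 0
    congr 1
    funext j
    rw [if_pos (bits_eq_zero_of_trivialOnL D q hprod hq1 hL j), Pi.zero_apply]
  -- descend to `Pic(𝒪₂)`
  let fbar : RingClassGroup (GenusField d) 2 →* Multiplicative (Fin m → ZMod 2) := ρ.liftOfSurjective hsurj ⟨f, hker⟩
  have hfbar : ∀ g : D.galK d, fbar (ρ g) = f g := fun g => ρ.liftOfRightInverse_comp_apply _ _ ⟨f, hker⟩ g
  -- kernel of `fbar` = squares
  have hkerbar : ∀ y, y ∈ fbar.ker ↔ IsSquare y := by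
    intro y
    obtain ⟨g, rfl⟩ := hsurj y
    rw [MonoidHom.mem_ker, hfbar, ← hsq g, hf]
    constructor
    · intro h0
      have h0' : ∀ j, (g : D.H ≃ₐ[ℚ] D.H) (D.im * D.sqrtNeg (q j)) = D.im * D.sqrtNeg (q j) := by
        intro j
        have := congrArg (fun x => (Multiplicative.toAdd x) j) h0
        simp only [bits, toAdd_ofAdd, toAdd_one, Pi.zero_apply] at this
        by_contra hne; rw [if_neg hne] at this; exact one_ne_zero this
      exact trivialOnL_of_bits_eq_zero D q hq hqinj hn hd hprod g.2 h0'
    · intro hL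
      change Multiplicative.ofAdd _ = Multiplicative.ofAdd 0
      congr 1; funext j
      rw [if_pos (bits_eq_zero_of_trivialOnL D q hprod hq1 hL j), Pi.zero_apply]
  -- count: `#range fbar = #G / #ker = 2^m`
  have hcard := natCard_ringClassGroup_two_eq D q hq hqodd hqinj hn hd hd8 hprod h hρ
  have hkercard : Nat.card fbar.ker = Nat.card {y : RingClassGroup (GenusField d) 2 // IsSquare y} :=
    Nat.card_congr (Equiv.subtypeEquivRight fun y => hkerbar y)
  have hrange : Nat.card fbar.range = 2 ^ m := by
    have h1 : Nat.card (RingClassGroup (GenusField d) 2) = Nat.card (_ ⧸ fbar.ker) * Nat.card fbar.ker :=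
      Subgroup.card_eq_card_quotient_mul_card_subgroup fbar.ker
    rw [Nat.card_congr (QuotientGroup.quotientKerEquivRange fbar).toEquiv, hkercard, hcard, mul_comm] at h1
    have hpos : 0 < Nat.card {y : RingClassGroup (GenusField d) 2 // IsSquare y} :=
      Nat.card_pos_iff.mpr ⟨⟨⟨(1 : RingClassGroup (GenusField d) 2), ⟨1, (mul_one (1 : RingClassGroup (GenusField d) 2)).symm⟩⟩⟩, inferInstance⟩
    exact (Nat.eq_of_mul_eq_mul_right hpos h1).symm
  have htop : fbar.range = ⊤ := by
    apply Subgroup.eq_top_of_card_eq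
    rw [hrange, Nat.card_eq_fintype_card, Fintype.card_multiplicative, Fintype.card_fun, ZMod.card, Fintype.card_fin]
  -- conclude
  have hmem : Multiplicative.ofAdd v ∈ fbar.range := by rw [htop]; exact Subgroup.mem_top _
  obtain ⟨y, hy⟩ := MonoidHom.mem_range.mp hmem
  obtain ⟨g, rfl⟩ := hsurj y
  rw [hfbar, hf] at hy
  refine ⟨g, g.2, fun j => ?_⟩
  have := congrArg (fun x => (Multiplicative.toAdd x) j) hy
  simpa only [bits, toAdd_ofAdd] using this

end Summit.BirchSwinnertonDyer.PrintCf2.MoverAssembly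

end
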